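import Literature.MathematicalPhysics.QuantumFieldTheory.Balaban1983to89.B13Core214EntryHolomorphic
import Literature.Analysis.Complex.OsgoodProofs

/-!
# `Balaban1983to89.B13JetFamilyLocality` — T. Bałaban, *Renormalization group approach to lattice gauge field
theories. I*, Commun. Math. Phys. **109** (1987) 249–301 [Balaban1987RG1], (1.7) p. 261, (1.18) p. 263, (4.3)–(4.5)
pp. 281–282, with [II] = *… II. Cluster expansions*, Commun. Math. Phys. **116** (1988) 1–22 [Balaban1988RG2Cluster],
(2.14)–(2.16) pp. 15–16: THE PRINTED LOCALITY *"the term corresponding to a domain X depends on U_j restricted to X"*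
(p. 261, after (1.7)) TRANSFERS FROM A TERM's KERNEL ENTRIES TO ITS JET FAMILY AND TO EVERY OBJECT BUILT ON THE
ENTRIES — the objects-side item (J3) «(1.7)-factorisation `hfac` for the jet objects from the locality mechanism» of
the second-order jet lift «W-jet2», REDUCED to entry-level locality of the family

statement-level skeleton of published theorems with citation tags; proofs where landed; nothing here is a claim about
the Yang–Mills mass gap

CITATION HEADER (verbatim): [Balaban1987RG1] p. 261, after (1.7): *"Again, the term corresponding to a domain X
depends on U_j restricted to X."*; p. 263, before (1.18): *"It depends on the configurations restricted to X, i.e. on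
(U, J)|_X. It is a C^∞-function of g_{j−1} ∈ [0, γ], (or analytic)"*.  [Balaban1988RG2Cluster] p. 15: *"The quadratic
forms and covariances in H(Z) are analytic functions on the space of configurations (𝐔, 𝐉)"*.

WHY THIS FILE (row (D4) OWNER `b2b-balaban-beta-an4`, gen 118; third of the (J2′)∕(J3) files after
`B13Core214EntryHolomorphic` (p435418) and `B13Term214JetAgreement`).  The (D4) wall consumes locality as the field
`hfac` of `Beta.RemainderLocality.PolLeavesTFac` ∕ `Beta.RemainderLocalityHolo.PolLeavesTFac190H`: on the `α₂`-ball
the activity FACTORS through a continuous linear RESTRICTION `r : W →L[ℂ] V` to an n-independent configuration space,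
`𝐄(v) = F (r v)`, with `F` analytic at `0` (`hF`).  The cell `ym-nodeO-ideate` (memo `ROUTE-P3.md` v3.15 §0.16 (e),
census C88) asks, for the objects built on the JET family `NodeOJetFamily.kjet 𝒦` (every kernel entry replaced by its
second-order Taylor polynomial at the base configuration), the same factorisation — item (J3), addressed to «the
objects seats (NODE 00 ∕ beta-an4)».  This file proves it MODULO ENTRY-LEVEL LOCALITY OF THE FAMILY: if on a ball
the entries factor through `r`, `entries 𝒦 σ u = Er (r u)` with `Er` holomorphic near `0` (§2 `hfac`, `hEr` — the
object-level content of p. 261 for Bałaban's `Γ_k(Z₀,σ)`, `C^{(k)}(Z₀,σ)⁻¹`, NOT supplied here), then the jet family's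
entries factor through `r` EVERYWHERE, `entries (kjet 𝒦) σ u = Erʲᵉᵗ (r u)` with `Erʲᵉᵗ v i = jet2 (Er · i) v`
(§2 `entries_kjet_fac`; mechanism §1 `jet2_comp_clm`: the second-order Taylor polynomial of `g ∘ r` is that of `g`
composed with `r` — chain rule + this lineage's `Beta.RemainderLocality.mixedDeriv_comp_clm`, and germ invariance
`NodeOJetCalculus.jet2_congr`), so EVERY object `Φ ∘ entries (kjet 𝒦) σ` factors as `(Φ ∘ Erʲᵉᵗ) ∘ r` (§3
`jet_object_fac` — the `hfac` shape, on the whole space), with the local factor `Φ ∘ Erʲᵉᵗ` holomorphic near `0`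
whenever `Φ` is holomorphic near `Er 0` and `Er` is bounded on its ball (§3 `differentiable_jetEntries`,
`differentiableOn_jetFactor`; ANALYTIC at `0` on a finite-dimensional restricted configuration space by the tree's
Osgood lemma `Literature.Analysis.Complex.SCV.analyticAt_of_differentiableOn` — `analyticAt_jetFactor`, the wall's
`hF` shape).

WHAT IS REPRODUCED: §1 `jet2_comp_clm`; §2 `entries_kjet_fac`; §3 `jet_object_fac`, `differentiable_jetEntries`,
`differentiableOn_jetFactor`, `analyticAt_jetFactor`.
HONEST SCOPE.  [folklore] calculus over the tree's `jet2` ∕ `mixedDeriv`; the entry-level factorisation `hfac`, the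
holomorphy and the bound of `Er` are HYPOTHESES (for Bałaban's operators they are NODE O's object-level content, p. 261
∕ p. 13 by construction of the localized random-walk expansions — not asserted); `Φ` is any function of the entries
(for lines 2–4 of (2.14): `B13Core214EntryHolomorphic.differentiableOn_core214_entries`).  Nothing of Bałaban's
constructed; row (D4) instance 0∕1, T⁴ spine 0∕9 UNCHANGED; NOT NODE O, NOT [B12] Thm 2, NOT continuum, NOT mass gap,
NOT Clay.  No `sorry`, no definition, no named fact, no instance, no notation.
-/

noncomputable section

namespace Literature.MathematicalPhysics.QuantumFieldTheory.Balaban1983to89.B13JetFamilyLocality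

open Metric Set Filter
open scoped Topology
open B13TermWalkData (TermKernels)
open NodeOJetCalculus (jet2 jet2_zero jet2_congr differentiable_jet2)
open NodeOJetFamily (kjet entries)
open B12Decay510 (mixedDeriv)
open B12Decay510Holo (norm_mixedDeriv_le_of_differentiableOn)
open Beta.RemainderLocality (mixedDeriv_comp_clm)

variable {W V : Type*} [NormedAddCommGroup W] [NormedSpace ℂ W] [NormedAddCommGroup V] [NormedSpace ℂ V]

/-! ## §1 The second-order Taylor polynomial through a continuous linear map -/

/-- **`jet₂(g ∘ r) = jet₂(g) ∘ r`** for a continuous linear `r : W →L[ℂ] V` and `g` holomorphic on a ball around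
`0 ∈ V`: value (`r 0 = 0`), first derivative (chain rule) and mixed second derivative
(`Beta.RemainderLocality.mixedDeriv_comp_clm`). [folklore] [cite: Balaban1987RG1, (4.3) p.281, (1.7) p.261] -/
theorem jet2_comp_clm (r : W →L[ℂ] V) {g : V → ℂ} {ρ : ℝ} (hρ : 0 < ρ) (hg : DifferentiableOn ℂ g (ball 0 ρ)) :
    jet2 (fun w => g (r w)) = fun w => jet2 g (r w) := by
  funext w
  have hga : ∀ y ∈ ball (0 : V) ρ, DifferentiableAt ℂ g y :=
    fun y hy => hg.differentiableAt (isOpen_ball.mem_nhds hy)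
  have h0 : DifferentiableAt ℂ g (r 0) := by
    rw [map_zero]; exact hga 0 (mem_ball_self hρ)
  have h1 : fderiv ℂ (fun w => g (r w)) 0 w = fderiv ℂ g 0 (r w) := by
    rw [show (fun w => g (r w)) = g ∘ r from rfl, fderiv_comp 0 h0 r.differentiableAt,
      ContinuousLinearMap.fderiv, ContinuousLinearMap.comp_apply, map_zero]
  have h2 : mixedDeriv (fun w => g (r w)) w w = mixedDeriv g (r w) (r w) := mixedDeriv_comp_clm hρ hga r w w
  show g (r 0) + fderiv ℂ (fun w => g (r w)) 0 w + (1 / 2 : ℂ) * mixedDeriv (fun w => g (r w)) w w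
    = g 0 + fderiv ℂ g 0 (r w) + (1 / 2 : ℂ) * mixedDeriv g (r w) (r w)
  rw [map_zero, h1, h2]

/-! ## §2 Entry-level locality of a kernel family transfers to its jet family -/

section Entries

variable {c : B13.Consts} {d N' ν : ℕ} {Nf : Fin ν → ℕ} [∀ i, NeZero (Nf i)]

/-- **ENTRY-LEVEL (1.7)-LOCALITY ⟹ LOCALITY OF THE JET FAMILY, EVERYWHERE.**  If on the `ρ`-ball of configurations
the kernel entries of a term factor through a continuous linear restriction `r : W →L[ℂ] V`,
`entries 𝒦 σ u = Er (r u)`, with every component of `Er` holomorphic on a ball around `0 ∈ V`, then the entries of the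
jet family factor through `r` at EVERY configuration: `entries (kjet 𝒦) σ u = (v ↦ (jet2 (Er · i) v)_i) (r u)`
(germ invariance `jet2_congr` + §1). [cite: Balaban1987RG1, (1.7) p.261, (1.18) p.263; Balaban1988RG2Cluster, (2.14)–(2.16) pp.15–16] -/
theorem entries_kjet_fac (𝒦 : TermKernels c d N' ν Nf W) (σ : TreeLengthTorus.TPt d N' → ℂ) (r : W →L[ℂ] V)
    {ρ ρ' : ℝ} (hρ : 0 < ρ) (hρ' : 0 < ρ')
    {Er : V → ((𝒦.Λ × (𝒦.Λ ⊕ 𝒦.C₀)) ⊕ (𝒦.Λ × 𝒦.Λ)) → ℂ}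
    (hEr : ∀ i, DifferentiableOn ℂ (fun v => Er v i) (ball 0 ρ'))
    (hfac : ∀ u ∈ ball (0 : W) ρ, entries 𝒦 σ u = Er (r u)) (u : W) :
    entries (kjet 𝒦) σ u = fun i => jet2 (fun v => Er v i) (r u) := by
  funext i
  have hev : (fun u' => entries 𝒦 σ u' i) =ᶠ[𝓝 (0 : W)] (fun u' => Er (r u') i) := by
    filter_upwards [isOpen_ball.mem_nhds (mem_ball_self hρ)] with u' hu'
    rw [hfac u' hu']
  have key : jet2 (fun u' => entries 𝒦 σ u' i) u = jet2 (fun v => Er v i) (r u) := by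
    rw [jet2_congr hev]
    exact congrFun (jet2_comp_clm r hρ' (hEr i)) u
  rcases i with ⟨b, j⟩ | ⟨b, b'⟩
  · exact key
  · exact key

end Entries

/-! ## §3 Hence every object built on the jet family's entries is LOCAL (`hfac`), with a holomorphic local factor -/

section Objects

variable {c : B13.Consts} {d N' ν : ℕ} {Nf : Fin ν → ℕ} [∀ i, NeZero (Nf i)]

/-- **(J3) MODULO ENTRY-LEVEL LOCALITY — the `hfac` shape of `Beta.RemainderLocality.PolLeavesTFac` for every object
on the jet family**: `Φ (entries (kjet 𝒦) σ u) = (Φ ∘ Erʲᵉᵗ) (r u)` at EVERY configuration `u`, where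
`Erʲᵉᵗ v = (jet2 (Er · i) v)_i` — the object factors through the restriction `r` with the configuration-space-independent
local factor `Φ ∘ Erʲᵉᵗ`. [cite: Balaban1987RG1, (1.7) p.261, (1.18) p.263; Balaban1988RG2Cluster, (2.14)–(2.16) pp.15–16] -/
theorem jet_object_fac (𝒦 : TermKernels c d N' ν Nf W) (σ : TreeLengthTorus.TPt d N' → ℂ) (r : W →L[ℂ] V)
    {ρ ρ' : ℝ} (hρ : 0 < ρ) (hρ' : 0 < ρ')
    {Er : V → ((𝒦.Λ × (𝒦.Λ ⊕ 𝒦.C₀)) ⊕ (𝒦.Λ × 𝒦.Λ)) → ℂ}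
    (hEr : ∀ i, DifferentiableOn ℂ (fun v => Er v i) (ball 0 ρ'))
    (hfac : ∀ u ∈ ball (0 : W) ρ, entries 𝒦 σ u = Er (r u))
    {T : Type*} (Φ : (((𝒦.Λ × (𝒦.Λ ⊕ 𝒦.C₀)) ⊕ (𝒦.Λ × 𝒦.Λ)) → ℂ) → T) (u : W) :
    Φ (entries (kjet 𝒦) σ u) = (Φ ∘ fun v i => jet2 (fun v' => Er v' i) v) (r u) := by
  rw [entries_kjet_fac 𝒦 σ r hρ hρ' hEr hfac u]; rfl

/-- **The jet of the restricted entries is ENTIRE** when `Er` is holomorphic and bounded on a ball around `0`: each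
component `v ↦ jet2 (Er · i) v` is a polynomial of degree two whose quadratic part is bounded by the Cauchy estimate
`‖∂²Erᵢ(v,w)‖ ≤ 4Sρ′⁻²‖v‖‖w‖` (`B12Decay510Holo.norm_mixedDeriv_le_of_differentiableOn`,
`NodeOJetCalculus.differentiable_jet2`). [cite: Balaban1987RG1, (4.3)–(4.5) pp.281–282, (1.18) p.263] -/
theorem differentiable_jetEntries {ι : Type*} [Fintype ι] {ρ' S : ℝ} (hρ' : 0 < ρ') {Er : V → ι → ℂ}
    (hEr : ∀ i, DifferentiableOn ℂ (fun v => Er v i) (ball 0 ρ'))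
    (hbd : ∀ i, ∀ v ∈ ball (0 : V) ρ', ‖Er v i‖ ≤ S) :
    Differentiable ℂ (fun v i => jet2 (fun v' => Er v' i) v) :=
  differentiable_pi.2 fun i =>
    differentiable_jet2 hρ' (hEr i) fun v w => norm_mixedDeriv_le_of_differentiableOn hρ' (hEr i) (hbd i) v w

/-- **The local factor of a jet object is holomorphic near `0`**: for `Φ` holomorphic on an open set `U` of entries,
`Φ ∘ Erʲᵉᵗ` is holomorphic on the open preimage `(Erʲᵉᵗ)⁻¹ U`, which contains `0` as soon as `Er 0 ∈ U`
(`jet2 g 0 = g 0`). [cite: Balaban1987RG1, (1.18) p.263, (4.3)–(4.4) pp.281–282] -/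
theorem differentiableOn_jetFactor {ι : Type*} [Fintype ι] {ρ' S : ℝ} (hρ' : 0 < ρ') {Er : V → ι → ℂ}
    (hEr : ∀ i, DifferentiableOn ℂ (fun v => Er v i) (ball 0 ρ'))
    (hbd : ∀ i, ∀ v ∈ ball (0 : V) ρ', ‖Er v i‖ ≤ S)
    {T : Type*} [NormedAddCommGroup T] [NormedSpace ℂ T] {Φ : (ι → ℂ) → T} {U : Set (ι → ℂ)} (hU : IsOpen U)
    (hΦ : DifferentiableOn ℂ Φ U) :
    IsOpen ((fun v i => jet2 (fun v' => Er v' i) v) ⁻¹' U) ∧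
      DifferentiableOn ℂ (Φ ∘ fun v i => jet2 (fun v' => Er v' i) v) ((fun v i => jet2 (fun v' => Er v' i) v) ⁻¹' U) ∧
      (Er 0 ∈ U → (0 : V) ∈ (fun v i => jet2 (fun v' => Er v' i) v) ⁻¹' U) := by
  have hd := differentiable_jetEntries hρ' hEr hbd
  refine ⟨hU.preimage hd.continuous, hΦ.comp hd.differentiableOn (mapsTo_preimage _ U), fun h0 => ?_⟩
  have e0 : (fun i => jet2 (fun v' => Er v' i) (0 : V)) = Er 0 := funext fun i => jet2_zero _
  show (fun i => jet2 (fun v' => Er v' i) (0 : V)) ∈ U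
  rw [e0]; exact h0

/-- **… AND ANALYTIC AT `0` on a finite-dimensional restricted configuration space** (the `hF` field of
`Beta.RemainderLocality.PolLeavesTFac`: `AnalyticAt ℂ (F Y) 0`) — the tree's Osgood lemma
`Literature.Analysis.Complex.SCV.analyticAt_of_differentiableOn`. [cite: Balaban1987RG1, (1.18) p.263; HormanderSCV1973, Thm 2.2.1 and Thm 2.2.6] -/
theorem analyticAt_jetFactor [FiniteDimensional ℂ V] {ι : Type*} [Fintype ι] {ρ' S : ℝ} (hρ' : 0 < ρ')
    {Er : V → ι → ℂ} (hEr : ∀ i, DifferentiableOn ℂ (fun v => Er v i) (ball 0 ρ'))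
    (hbd : ∀ i, ∀ v ∈ ball (0 : V) ρ', ‖Er v i‖ ≤ S)
    {T : Type*} [NormedAddCommGroup T] [NormedSpace ℂ T] [CompleteSpace T] {Φ : (ι → ℂ) → T} {U : Set (ι → ℂ)}
    (hU : IsOpen U) (hΦ : DifferentiableOn ℂ Φ U) (h0 : Er 0 ∈ U) :
    AnalyticAt ℂ (Φ ∘ fun v i => jet2 (fun v' => Er v' i) v) 0 := by
  obtain ⟨hO, hD, hz⟩ := differentiableOn_jetFactor hρ' hEr hbd hU hΦ
  exact Literature.Analysis.Complex.SCV.analyticAt_of_differentiableOn hD hO (hz h0)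

end Objects

end Literature.MathematicalPhysics.QuantumFieldTheory.Balaban1983to89.B13JetFamilyLocality

end
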